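import Mathlib
import Literature.MathematicalPhysics.QuantumFieldTheory.Balaban1983to89.B5Prop11Lower

/-!
# Beta / TentQuasiReconstructionForms — two generic quadratic-form bounds for the E-I3 instance: the ENERGY of a
# superposition `Σ_y B_y f_y` through weighted Cauchy–Schwarz (`Σ_x ‖Σ_y f_y(x)B_y‖² ≤ S·T·‖B‖²` when `|f_y(x)| ≤ a_y(x)`
# with `Σ_y a_y(x) ≤ S`, `Σ_x a_y(x) ≤ T`) and the MASS form from two-sided diagonal dominance (rows AND columns; no
# Hermitian hypothesis): `Re B*MB ≥ (δ − (σ_r + σ_c)/2)‖B‖²` (unit `b2b-balaban-beta-d4-p2`, GEN 5, MODEL crew; for the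
# hypotheses `hen` ∕ `hmass` of an4's `CoarseCoerciveQuasiReconstruction.sandwich_coercive_of_quasiReconstruction`)

HONEST FRAMING: discharging `BetaPertH` makes Bałaban's UV stability UNCONDITIONAL — NOT the continuum limit, NOT the
Clay problem.  HONEST DEPENDENCY (verbatim): «continuum YM on T⁴ ⇐ BetaPertH ∧ nine spine estimates (0/9 proved);
BetaPertH ⇐ (D1) ∧ (D4) ∧ CAP+tail; G-an2-4 gates asym, D1 and NE2/3/4.»  THIS MODULE DISCHARGES NOTHING of `BetaPertH`,
asserts NOTHING printed and cites nothing as a fact (ABSOLUTE RULE): [folklore] finite-dimensional inequalities.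

CONTENT.  §1 `sq_sum_le_sum_mul_sum_sq` (weighted Cauchy–Schwarz), `norm_sq_superpos_le`, **`sum_norm_sq_superpos_le`**.
§2 **`re_form_ge_of_rowcol`** (Gershgorin-type lower bound of `Re B*MB` from the real parts of the diagonal and the
off-diagonal row and column ℓ¹ sums; an4's `re_form_ge_of_diagDominant` is the Hermitian case σ_r = σ_c).
Row D4: RECORDS value (infrastructure of E-I3 at U = 1); class of (I3)/G-B9-15 unchanged; D4 DISCHARGE NO DATE; NOT BetaPertH,
NOT continuum, NOT Clay.
-/

namespace Summit.QuantumFields.BalabanUV.Beta.TentQuasiReconstructionForms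

open Finset Matrix
open scoped BigOperators ComplexConjugate
open Literature.MathematicalPhysics.QuantumFieldTheory.Balaban1983to89.B5Prop11Lower (nsq nsq_nonneg)

noncomputable section

variable {X Y : Type*} [Fintype X] [Fintype Y]

/-! ## §1  The energy of a superposition by weighted Cauchy–Schwarz -/

omit [Fintype X] in
/-- **Weighted Cauchy–Schwarz**: `(Σ_y a_y b_y)² ≤ (Σ_y a_y)·(Σ_y a_y b_y²)` for `a ≥ 0`. [folklore] -/
theorem sq_sum_le_sum_mul_sum_sq (a b : Y → ℝ) (ha : ∀ y, 0 ≤ a y) :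
    (∑ y, a y * b y) ^ 2 ≤ (∑ y, a y) * ∑ y, a y * b y ^ 2 := by
  have h := Finset.sum_mul_sq_le_sq_mul_sq univ (fun y => Real.sqrt (a y)) (fun y => Real.sqrt (a y) * b y)
  have e1 : ∀ y, Real.sqrt (a y) * (Real.sqrt (a y) * b y) = a y * b y := fun y => by
    rw [← mul_assoc, Real.mul_self_sqrt (ha y)]
  have e2 : ∀ y, Real.sqrt (a y) ^ 2 = a y := fun y => Real.sq_sqrt (ha y)
  have e3 : ∀ y, (Real.sqrt (a y) * b y) ^ 2 = a y * b y ^ 2 := fun y => by rw [mul_pow, Real.sq_sqrt (ha y)]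
  simp only [e1, e2, e3] at h
  exact h

omit [Fintype X] in
/-- One site: `‖Σ_y f_y B_y‖² ≤ (Σ_y a_y)·(Σ_y a_y‖B_y‖²)` when `‖f_y‖ ≤ a_y`. [folklore] -/
theorem norm_sq_superpos_le (f : Y → ℂ) (a : Y → ℝ) (hf : ∀ y, ‖f y‖ ≤ a y) (B : Y → ℂ) :
    ‖∑ y, f y * B y‖ ^ 2 ≤ (∑ y, a y) * ∑ y, a y * ‖B y‖ ^ 2 := by
  have ha : ∀ y, 0 ≤ a y := fun y => (norm_nonneg _).trans (hf y)
  have h1 : ‖∑ y, f y * B y‖ ≤ ∑ y, a y * ‖B y‖ :=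
    (norm_sum_le _ _).trans (Finset.sum_le_sum fun y _ => by
      rw [norm_mul]; exact mul_le_mul_of_nonneg_right (hf y) (norm_nonneg _))
  calc ‖∑ y, f y * B y‖ ^ 2 ≤ (∑ y, a y * ‖B y‖) ^ 2 := pow_le_pow_left₀ (norm_nonneg _) h1 2
    _ ≤ (∑ y, a y) * ∑ y, a y * ‖B y‖ ^ 2 := sq_sum_le_sum_mul_sum_sq a (fun y => ‖B y‖) ha

/-- **All sites**: `Σ_x ‖Σ_y f_y(x)B_y‖² ≤ S·T·‖B‖²` when `‖f_y(x)‖ ≤ a_y(x)`, `Σ_y a_y(x) ≤ S` (every x, `S ≥ 0`) and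
`Σ_x a_y(x) ≤ T` (every y). [folklore] -/
theorem sum_norm_sq_superpos_le (f : Y → X → ℂ) (a : Y → X → ℝ) (hf : ∀ y x, ‖f y x‖ ≤ a y x) {S T : ℝ}
    (hS0 : 0 ≤ S) (hS : ∀ x, ∑ y, a y x ≤ S) (hT : ∀ y, ∑ x, a y x ≤ T) (B : Y → ℂ) :
    ∑ x, ‖∑ y, f y x * B y‖ ^ 2 ≤ S * T * nsq B := by
  have ha : ∀ y x, 0 ≤ a y x := fun y x => (norm_nonneg _).trans (hf y x)
  calc ∑ x, ‖∑ y, f y x * B y‖ ^ 2 ≤ ∑ x, (∑ y, a y x) * ∑ y, a y x * ‖B y‖ ^ 2 :=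
        Finset.sum_le_sum fun x _ => norm_sq_superpos_le (fun y => f y x) (fun y => a y x) (fun y => hf y x) B
    _ ≤ ∑ x, S * ∑ y, a y x * ‖B y‖ ^ 2 := Finset.sum_le_sum fun x _ =>
        mul_le_mul_of_nonneg_right (hS x) (Finset.sum_nonneg fun y _ => mul_nonneg (ha y x) (sq_nonneg _))
    _ = S * ∑ y, (∑ x, a y x) * ‖B y‖ ^ 2 := by
        rw [← Finset.mul_sum, Finset.sum_comm]
        congr 1
        exact Finset.sum_congr rfl fun y _ => by rw [Finset.sum_mul]
    _ ≤ S * ∑ y, T * ‖B y‖ ^ 2 := mul_le_mul_of_nonneg_left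
        (Finset.sum_le_sum fun y _ => mul_le_mul_of_nonneg_right (hT y) (sq_nonneg _)) hS0
    _ = S * T * nsq B := by rw [← Finset.mul_sum, nsq]; ring

/-! ## §2  The mass form from two-sided diagonal dominance -/

omit [Fintype X] in
/-- **Gershgorin-type form bound WITHOUT symmetry.**  A complex matrix `M` with `Re M_yy ≥ δ`, absolute off-diagonal ROW
sums `≤ σ_r` and absolute off-diagonal COLUMN sums `≤ σ_c` satisfies `Re B*·M·B ≥ (δ − (σ_r + σ_c)/2)‖B‖²`
(`|B_y||B_{y′}| ≤ (|B_y|² + |B_{y′}|²)/2`; the first halves are paid by the row sums, the second by the column sums). [folklore] -/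
theorem re_form_ge_of_rowcol [DecidableEq Y] (M : Matrix Y Y ℂ) {δ σr σc : ℝ} (hdiag : ∀ y, δ ≤ (M y y).re)
    (hrow : ∀ y, ∑ y' ∈ univ.erase y, ‖M y y'‖ ≤ σr) (hcol : ∀ y', ∑ y ∈ univ.erase y', ‖M y y'‖ ≤ σc) (B : Y → ℂ) :
    (δ - (σr + σc) / 2) * nsq B ≤ (star B ⬝ᵥ (M *ᵥ B)).re := by
  -- Re B*MB = Σ_y Re(M y y)|B_y|² + Σ_y Σ_{y' ≠ y} Re(conj B_y · M y y' · B_y')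
  have hsplit : (star B ⬝ᵥ (M *ᵥ B)).re =
      ∑ y, ((M y y).re * ‖B y‖ ^ 2 + ∑ y' ∈ univ.erase y, (star (B y) * (M y y' * B y')).re) := by
    simp only [dotProduct, Matrix.mulVec, Pi.star_apply, Complex.re_sum, Finset.mul_sum]
    refine Finset.sum_congr rfl fun y _ => ?_
    rw [← Finset.add_sum_erase _ _ (Finset.mem_univ y)]
    congr 1
    have hre : (star (B y) * (M y y * B y)) = M y y * ((‖B y‖ ^ 2 : ℝ) : ℂ) := by
      rw [Complex.star_def, mul_left_comm, Complex.conj_mul', Complex.ofReal_pow]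
    rw [hre, Complex.re_mul_ofReal]
  -- the off-diagonal part is bounded below by −Σ‖M y y'‖(|B y|² + |B y'|²)/2
  have hoffB : ∀ y, -(∑ y' ∈ univ.erase y, ‖M y y'‖ * ((‖B y‖ ^ 2 + ‖B y'‖ ^ 2) / 2)) ≤
      ∑ y' ∈ univ.erase y, (star (B y) * (M y y' * B y')).re := by
    intro y
    rw [← Finset.sum_neg_distrib]
    refine Finset.sum_le_sum fun y' _ => ?_
    have habs : |(star (B y) * (M y y' * B y')).re| ≤ ‖B y‖ * (‖M y y'‖ * ‖B y'‖) := by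
      refine (Complex.abs_re_le_norm _).trans ?_
      rw [norm_mul, norm_mul, norm_star]
    have hamgm : ‖B y‖ * (‖M y y'‖ * ‖B y'‖) ≤ ‖M y y'‖ * ((‖B y‖ ^ 2 + ‖B y'‖ ^ 2) / 2) := by
      have h2 : 2 * ‖B y‖ * ‖B y'‖ ≤ ‖B y‖ ^ 2 + ‖B y'‖ ^ 2 := two_mul_le_add_sq _ _
      nlinarith [norm_nonneg (M y y'), norm_nonneg (B y), norm_nonneg (B y')]
    linarith [(abs_le.1 habs).1]
  -- the two halves: rows and columns
  have hrows : ∑ y, ∑ y' ∈ univ.erase y, ‖M y y'‖ * ‖B y‖ ^ 2 ≤ σr * nsq B := by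
    calc ∑ y, ∑ y' ∈ univ.erase y, ‖M y y'‖ * ‖B y‖ ^ 2 = ∑ y, (∑ y' ∈ univ.erase y, ‖M y y'‖) * ‖B y‖ ^ 2 :=
          Finset.sum_congr rfl fun y _ => by rw [Finset.sum_mul]
      _ ≤ ∑ y, σr * ‖B y‖ ^ 2 := Finset.sum_le_sum fun y _ => mul_le_mul_of_nonneg_right (hrow y) (by positivity)
      _ = σr * nsq B := by rw [← Finset.mul_sum, nsq]
  have hcols : ∑ y, ∑ y' ∈ univ.erase y, ‖M y y'‖ * ‖B y'‖ ^ 2 ≤ σc * nsq B := by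
    rw [Finset.sum_comm' (t' := univ) (s' := fun y' => univ.erase y')
      (fun y y' => by simp only [Finset.mem_univ, Finset.mem_erase, ne_eq, and_true, true_and]; exact ne_comm)]
    calc ∑ y', ∑ y ∈ univ.erase y', ‖M y y'‖ * ‖B y'‖ ^ 2 = ∑ y', (∑ y ∈ univ.erase y', ‖M y y'‖) * ‖B y'‖ ^ 2 :=
          Finset.sum_congr rfl fun y' _ => by rw [Finset.sum_mul]
      _ ≤ ∑ y', σc * ‖B y'‖ ^ 2 := Finset.sum_le_sum fun y' _ => mul_le_mul_of_nonneg_right (hcol y') (by positivity)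
      _ = σc * nsq B := by rw [← Finset.mul_sum, nsq]
  have hhalf : ∑ y, ∑ y' ∈ univ.erase y, ‖M y y'‖ * ((‖B y‖ ^ 2 + ‖B y'‖ ^ 2) / 2) ≤ (σr + σc) / 2 * nsq B := by
    have e : ∑ y, ∑ y' ∈ univ.erase y, ‖M y y'‖ * ((‖B y‖ ^ 2 + ‖B y'‖ ^ 2) / 2) =
        (∑ y, ∑ y' ∈ univ.erase y, ‖M y y'‖ * ‖B y‖ ^ 2 + ∑ y, ∑ y' ∈ univ.erase y, ‖M y y'‖ * ‖B y'‖ ^ 2) / 2 := by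
      rw [← Finset.sum_add_distrib, Finset.sum_div]
      refine Finset.sum_congr rfl fun y _ => ?_
      rw [← Finset.sum_add_distrib, Finset.sum_div]
      exact Finset.sum_congr rfl fun y' _ => by ring
    rw [e]
    linarith
  have hdiagB : δ * nsq B ≤ ∑ y, (M y y).re * ‖B y‖ ^ 2 := by
    rw [nsq, Finset.mul_sum]
    exact Finset.sum_le_sum fun y _ => mul_le_mul_of_nonneg_right (hdiag y) (by positivity)
  rw [hsplit, Finset.sum_add_distrib]
  have hoff : -(∑ y, ∑ y' ∈ univ.erase y, ‖M y y'‖ * ((‖B y‖ ^ 2 + ‖B y'‖ ^ 2) / 2)) ≤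
      ∑ y, ∑ y' ∈ univ.erase y, (star (B y) * (M y y' * B y')).re := by
    rw [← Finset.sum_neg_distrib]
    exact Finset.sum_le_sum fun y _ => hoffB y
  linarith

end

end Summit.QuantumFields.BalabanUV.Beta.TentQuasiReconstructionForms
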